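import Summits.BirchSwinnertonDyer.BirchSwinnertonDyer.Theorems.GenusKolyvaginAtTwoMinimalTwinBSDTwoRouteLedgerLine25
import Summits.BirchSwinnertonDyer.BirchSwinnertonDyer.Theorems.KolyvaginDepthDoorSurjectiveModPQuadraticTwist
import HarnessLib

/-!
# Route `GenusKolyvaginAtTwo` (rev 57): `closes` consumes U₂ `MinimalTwinBSDTwo` (stmt-BirchSwinnertonDyer-22985) only on curves with
# SURJECTIVE mod-2 representation (`Gal(ℚ(W[2])/ℚ) ≅ S₃`) — the two Tamagawa cells sliced once more, for free

Seat `bsd-line-gk2-p3` g28 (PROVER seat 3/3, cell `bsd-f1-sign2`), `--supports stmt-BirchSwinnertonDyer-22985` (helper; closes nothing).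
THEOREMS ONLY (no definition, no named fact, no `sorry`); standard axioms.  **BSD is NOT proved by this file; U₂ and the cells are NOT proved;
no item is closed.**  CONDITIONAL on the route's items exactly like `closes` (rev 57) — it is `Line25.nonCMAtTwo_of_items_of_tamagawaSlicedTwin_line25`
(p768790) with the two cells WEAKENED ONCE MORE.

WHY IT IS FREE.  At all four call sites of `hTw` in `closes` the twin `Wd = Cd • E^(d_K)` is the twist of a habitat curve `E` with
`ρ̄_{E,2^n}` onto for every `n` (binder `hρ` of both supply cruxes); surjectivity mod a prime is twist- and model-invariant
(`KolyvaginDepthDoor.hasSurjectiveModNGaloisRep_quadraticTwist` / `…_smul`, tree, unconditional: `E^(d)[p] ≅ E[p] ⊗ χ_d`), so `ρ̄_{Wd,2}` is onto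
`GL₂(𝔽₂) ≅ S₃`: the `2`-division field of every twin U₂ is ever applied to is an `S₃`-extension (cubic irreducible, non-square discriminant;
in particular `Wd(ℚ)[2] = 0`).

* **`nonCMAtTwo_of_items_of_tamagawaSlicedSurjTwin_line25`** — `closes` (rev 57, 18 binders) with `hTw : MinimalTwinBSDTwo` REPLACED by
  `hTw0ˢ` := `BSD₂(W)` for non-CM globally minimal `W` with `r_an = 1`, `#Sel₂(W) = 2`, **`ρ̄_{W,2}` surjective**, `0 < Δ_W`, `ord₂ C(W) = 0`, and
  `hTw1ˢ` := the same with `Δ_W < 0`, `ord₂ C(W) = 1`; every other binder and proof line verbatim.  Since `hTw0 ⟹ hTw0ˢ`, `hTw1 ⟹ hTw1ˢ`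
  trivially, p768790's §1 and every ledger built on it (`…RouteLedgerLine25Supplies`, `…Line25Prime`) hold with the `S₃` clause added to the
  cells; the reversed supplies S2″ / S2″′ / S2⁻′ may likewise assume `ρ̄_{W,2}` onto (LINE 23's engines are stated without it — a free
  strengthening of their habitat, matching the `S₃` hypothesis of every Heegner-point argument at `p = 2`).
  NET (planner currency): **U₂|`closes` ≡ hTw0ˢ + hTw1ˢ — U₂ is needed only for `S₃`-curves on the two Tamagawa cells.**

References: [Kramer1981] §2 Prop. 3; [GrossLMS1991] §2; [SilvermanAEC2009] III.1 Table 3.1, X.§5; [Miller2011LMS] Def. 1.1.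
-/

set_option autoImplicit false
set_option linter.dupNamespace false -- `Summit.<P>.<Sub>` repeats `BirchSwinnertonDyer` (D-0017)

noncomputable section

open scoped Classical

open WeierstrassCurve NumberField Literature.NumberTheory.EllipticCurves
  Literature.NumberTheory.EllipticCurves.ModularForms
  Summit.BirchSwinnertonDyer.BirchSwinnertonDyer.Rank1Residual
  Summit.BirchSwinnertonDyer.BirchSwinnertonDyer.Theses.GenusKolyvaginAtTwo
  Summit.BirchSwinnertonDyer.BirchSwinnertonDyer.Theorems.GenusExact.PlusDescent
  Summit.BirchSwinnertonDyer.BirchSwinnertonDyer.Theorems.KolyvaginDepthDoor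

namespace Summit.BirchSwinnertonDyer.BirchSwinnertonDyer.Theorems.GenusExact.TwinSwap.Ledger.Line25

/-- **THE ROUTE (rev 57) CONSUMES U₂ ONLY ON `S₃`-CURVES OF THE TWO TAMAGAWA CELLS.**  `GenusKolyvaginAtTwo.closes` (rev 57) with its
binder `hTw : MinimalTwinBSDTwo` REPLACED by `hTw0ˢ` — `BSD₂(W)` for non-CM globally minimal `W` of analytic rank `1` with `#Sel₂(W) = 2`,
**`ρ̄_{W,2}` surjective, `0 < Δ_W`, `ord₂ C(W) = 0`** — and `hTw1ˢ` — the same with **`Δ_W < 0`, `ord₂ C(W) = 1`**; all other binders and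
every proof line VERBATIM from `closes`; at each call site the twin inherits `ρ̄₂` onto from the habitat curve (`hasSurjectiveModNGaloisRep_
quadraticTwist` / `_smul`), its sign of `Δ` (`Δ_twin_neg_iff` / `_pos_iff`) and its cell (`ord₂ C(Wd) = 1` by supply + genus parity, resp.
`= 0`).  CONDITIONAL on the route's items (as `closes` is); proves nothing about BSD by itself; closes no item.
[cite: Kramer1981, §2 Prop. 3] [cite: SilvermanAEC2009, III.1 Table 3.1] [cite: Miller2011LMS, Def. 1.1] -/
theorem nonCMAtTwo_of_items_of_tamagawaSlicedSurjTwin_line25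
    (hP : GenusPrimitiveSupplyAtTwoPosDiscShallow) (hPG : GenusDeepSupplyAtTwoNegDiscNarrow) (hQ1 : CyclicTorsionOfNegDisc)
    (hQ2 : KolyvaginRelationAtTwo)
    (hQ5R : EquivariantChebotarevAtTwoR) (hQ3RT : EquivariantKolyvaginExactAtTwoRT)
    (hQ4T : KolyvaginExactAtTwoPosDiscT) (hGf : ExactDescentAtTwoOfFourFacts)
    (hR : OffHabitatResidualAtTwo) (hOff : OffCutResidualAtTwoR)
    (hK1P : K1Pos) (hK1N : K1Neg) (hSha1 : ShaVanishingAtDepthZeroAtTwo)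
    (hTw0s : ∀ (W : WeierstrassCurve ℚ) [W.IsElliptic] [W.IsGloballyMinimal], ¬ W.HasCM → W.analyticRank = 1 →
      Nat.card (W.selmerGroup 2) = 2 → W.HasSurjectiveModNGaloisRep 2 → 0 < W.Δ → padicValNat 2 W.tamagawaProduct = 0 → BSDp W 2)
    (hTw1s : ∀ (W : WeierstrassCurve ℚ) [W.IsElliptic] [W.IsGloballyMinimal], ¬ W.HasCM → W.analyticRank = 1 →
      Nat.card (W.selmerGroup 2) = 2 → W.HasSurjectiveModNGaloisRep 2 → W.Δ < 0 → padicValNat 2 W.tamagawaProduct = 1 → BSDp W 2)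
    (hL : EntireLFunctionRat)
    (hGZ : GrossZagierAllLevels) (hGZK : MultPublishedInputsAtTwo) (hMi : MilneAnyModel) :
    NonCMAtTwo := by
  have hG : ExactDescentAtTwo := hGf ⟨hGZ, hGZK, hL, hMi⟩
  intro W _ _ hcm hr
  haveI : NeZero (W.conductorNorm ℤ) := ⟨(W.conductorNorm_pos_holds).ne'⟩
  by_cases hH : (W.analyticRank = 0 ∧ (∀ n : ℕ, 0 < n → W.HasSurjectiveModNGaloisRep ((2 : ℤ) ^ n)) ∧
        Odd W.tamagawaProduct ∧
        ∃ Dt : Literature.NumberTheory.EllipticCurves.ModularForms.ModularParametrizationData W (W.conductorNorm ℤ),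
          (∀ z ∈ Dt.L.lattice, ∃ w ∈ Literature.NumberTheory.EllipticCurves.ModularForms.periodLattice Dt.f, z = (Dt.c : ℂ) * w) ∧ Odd Dt.c)
  · obtain ⟨hr0, hρ, hT, hopt⟩ := hH
    -- `ρ̄_{E,2}` onto, in the `ℕ`-cast form the twist lemmas want
    haveI : Fact (Nat.Prime 2) := ⟨Nat.prime_two⟩
    have hρ2 : W.HasSurjectiveModNGaloisRep ((2 : ℕ) : ℤ) := by simpa using hρ 1 one_pos
    -- an elliptic curve has `Δ ≠ 0`
    have hΔ : W.Δ ≠ 0 := by rw [← WeierstrassCurve.coe_Δ']; exact W.Δ'.ne_zero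
    -- `w(E) = +1` from `r_an(E) = 0` (used on both signs)
    have hw : ∀ Dt : Literature.NumberTheory.EllipticCurves.ModularForms.ModularParametrizationData W (W.conductorNorm ℤ),
        W.rootNumber = 1 := fun Dt ↦
      (Literature.Barriers.BirchSwinnertonDyer.even_analyticRank_iff_of_isNewformOf_conductorLevel Dt.isNewformOf).mp
        (by rw [hr0]; exact Even.zero)
    -- the two cells, once per sign: the consumed twin has `ρ̄₂` onto, `sign Δ(Wd) = sign Δ_E` and `ord₂ C(Wd) = 1` resp. `= 0`
    have hcell1 : W.Δ < 0 → ∀ (K : Type) [Field K] [NumberField K], IsImaginaryQuadratic K → Odd (NumberField.discr K) →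
        SatisfiesHeegnerHypothesis (W.conductorNorm ℤ) K → ∀ (Wd : WeierstrassCurve ℚ) [Wd.IsElliptic] [Wd.IsGloballyMinimal],
        (∃ C : VariableChange ℚ, C • W.quadraticTwist (NumberField.discr K : ℚ) = Wd) → ¬ Wd.HasCM → Wd.analyticRank = 1 →
        Nat.card (Wd.selmerGroup 2) = 2 → padicValNat 2 Wd.tamagawaProduct ≤ 1 → BSDp Wd 2 := by
      intro hneg K _ _ hIQ hodd hHe Wd _ _ hWd hcmd hrd hSel hDEF
      obtain ⟨Cd, hCd⟩ := hWd
      have hD0 : (NumberField.discr K : ℚ) ≠ 0 := by exact_mod_cast NumberField.discr_ne_zero K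
      haveI := W.isElliptic_quadraticTwist hD0
      have hΔd : Wd.Δ < 0 := (Δ_twin_neg_iff W hD0 Cd hCd).mpr hneg
      obtain ⟨k, hk⟩ := odd_padicValNat_two_tamagawaProduct_twin_of_Δ_neg W hIQ hodd hHe hT hneg Cd hCd
      have h1 : padicValNat 2 Wd.tamagawaProduct = 1 := by omega
      have hρd' : Wd.HasSurjectiveModNGaloisRep ((2 : ℕ) : ℤ) := by
        have h := KolyvaginDepthDoor.hasSurjectiveModNGaloisRep_smul (W.quadraticTwist (NumberField.discr K : ℚ)) Cd 2
          (KolyvaginDepthDoor.hasSurjectiveModNGaloisRep_quadraticTwist W hD0 2 hρ2)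
        rwa [hCd] at h
      exact hTw1s Wd hcmd hrd hSel (by simpa using hρd') hΔd h1
    have hcell0 : 0 < W.Δ → ∀ (K : Type) [Field K] [NumberField K],
        ∀ (Wd : WeierstrassCurve ℚ) [Wd.IsElliptic] [Wd.IsGloballyMinimal],
        (∃ C : VariableChange ℚ, C • W.quadraticTwist (NumberField.discr K : ℚ) = Wd) → ¬ Wd.HasCM → Wd.analyticRank = 1 →
        Nat.card (Wd.selmerGroup 2) = 2 → padicValNat 2 Wd.tamagawaProduct = 0 → BSDp Wd 2 := by
      intro hpos K _ _ Wd _ _ hWd hcmd hrd hSel hTam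
      obtain ⟨Cd, hCd⟩ := hWd
      have hD0 : (NumberField.discr K : ℚ) ≠ 0 := by exact_mod_cast NumberField.discr_ne_zero K
      haveI := W.isElliptic_quadraticTwist hD0
      have hΔd : 0 < Wd.Δ := (Δ_twin_pos_iff W hD0 Cd hCd).mpr hpos
      have hρd' : Wd.HasSurjectiveModNGaloisRep ((2 : ℕ) : ℤ) := by
        have h := KolyvaginDepthDoor.hasSurjectiveModNGaloisRep_smul (W.quadraticTwist (NumberField.discr K : ℚ)) Cd 2
          (KolyvaginDepthDoor.hasSurjectiveModNGaloisRep_quadraticTwist W hD0 2 hρ2)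
        rwa [hCd] at h
      exact hTw0s Wd hcmd hrd hSel (by simpa using hρd') hΔd hTam
    rcases lt_or_gt_of_ne hΔ with hneg | hpos
    · -- `Δ < 0`
      by_cases hmult : ∃ v : IsDedekindDomain.HeightOneSpectrum (NumberField.RingOfIntegers ℚ),
          ((2 : ℕ) : NumberField.RingOfIntegers ℚ) ∉ v.asIdeal ∧
          ((W.conductorNorm ℤ : ℕ) : NumberField.RingOfIntegers ℚ) ∈ v.asIdeal ∧ W.HasMultiplicativeReductionAt v
      · by_cases h14 : Nat.card (W.selmerGroup 2) = 1 ∨ Nat.card (W.selmerGroup 2) = 4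
        · obtain ⟨v, h2v, hNv, hmv⟩ := hmult
          obtain ⟨K, _, _, hIQ, hodd, h3, hHe, hsq1, hsq2, Dt, β, ι, d₁, hoptDt, hc, hy, M₀, hdiv, hndiv,
            n, d, hn, hKoly, hPn, Wd, _, _, hWd, hcmd, hrd, hSel, hDEF⟩ := hPG W hcm hr0 hρ hT hneg hopt h14
          have hBd : Literature.NumberTheory.EllipticCurves.BSDp Wd 2 := hcell1 hneg K hIQ hodd hHe Wd hWd hcmd hrd hSel hDEF
          exact hG W hcm hr0 hρ hT K hIQ hodd h3 hHe Dt hoptDt hc β ι d₁ hy M₀ hdiv hndiv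
            (hQ3RT hQ2 hQ5R hQ1 W hcm hT v h2v hNv hmv hneg K hIQ hodd h3 hHe hsq1 hsq2 hρ Dt β ι d₁ hy M₀ hdiv hndiv
              (hw Dt) Wd hWd hSel hDEF n d hn hKoly hPn)
            Wd hWd hSel hBd
        · exact hOff W hcm hr0 hρ hT hopt (Or.inr (Or.inl ⟨hneg, h14⟩))
      · -- rev 54 (LINE 25 «s1_depth_zero»): additive-only at DEPTH ZERO — supply VERBATIM, K₁, v-free `Ш(E/K)[2^∞] = 0`
        by_cases h1 : Nat.card (W.selmerGroup 2) = 1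
        · obtain ⟨K, _, _, hIQ, hodd, h3, hHe, hsq1, hsq2, Dt, β, ι, d₁, hoptDt, hc, hy, M₀, hdiv, hndiv,
            n, d, hn, hKoly, hPn, Wd, _, _, hWd, hcmd, hrd, hSel, hDEF⟩ := hPG W hcm hr0 hρ hT hneg hopt (Or.inl h1)
          have hM0 : M₀ = 0 := by
            by_contra hne
            exact hK1N W hcm hr0 hρ hT hneg h1 K hIQ hodd h3 hHe hsq1 hsq2 Dt hoptDt hc β ι d₁ hy M₀ hdiv hndiv
              (Nat.one_le_iff_ne_zero.mpr hne) Wd hWd hrd hSel hDEF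
          subst hM0
          have hSha : Nat.card (AddCommGroup.primaryComponent (W.baseChange K).sha 2) = 2 ^ (2 * 0) := by
            rw [mul_zero, pow_zero]
            exact hSha1 W K hT hr0 h1 hIQ hodd hHe (by simpa using hρ 1 one_pos) Dt β ι d₁ hy 0 hndiv Wd hWd hSel
              (Or.inl ⟨hneg, hDEF⟩)
          have hBd : Literature.NumberTheory.EllipticCurves.BSDp Wd 2 := hcell1 hneg K hIQ hodd hHe Wd hWd hcmd hrd hSel hDEF
          exact hG W hcm hr0 hρ hT K hIQ hodd h3 hHe Dt hoptDt hc β ι d₁ hy 0 hdiv hndiv hSha Wd hWd hSel hBd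
        · exact hOff W hcm hr0 hρ hT hopt (Or.inl ⟨hmult, h1⟩)
    · -- `Δ > 0`
      by_cases hmult : ∃ v : IsDedekindDomain.HeightOneSpectrum (NumberField.RingOfIntegers ℚ),
          ((2 : ℕ) : NumberField.RingOfIntegers ℚ) ∉ v.asIdeal ∧
          ((W.conductorNorm ℤ : ℕ) : NumberField.RingOfIntegers ℚ) ∈ v.asIdeal ∧ W.HasMultiplicativeReductionAt v
      · by_cases h14 : Nat.card (W.selmerGroup 2) = 1 ∨ (Nat.card (W.selmerGroup 2) = 4 ∧
            ∃ c ∈ (W.kummerSelmerStructure ((2 : ℕ) : ℤ)).selmerGroup,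
              Literature.NumberTheory.GaloisRepresentations.galoisCohomology.localization (W.torsionGaloisModule ((2 : ℕ) : ℤ))
                (Sum.inl Rat.infinitePlace) 1 c ≠ 0)
        · obtain ⟨v, h2v, hNv, hmv⟩ := hmult
          obtain ⟨K, _, _, hIQ, hodd, h3, hHe, hsq1, hsq2, Dt, β, ι, d₁, hoptDt, hc, hy, M₀, hdiv, hndiv,
            n, d, hn, hKoly, hPn, Wd, _, _, hWd, hcmd, hrd, hSel, hTam⟩ := hP W hcm hr0 hρ hT hpos hopt h14
          have hBd : Literature.NumberTheory.EllipticCurves.BSDp Wd 2 := hcell0 hpos K Wd hWd hcmd hrd hSel hTam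
          exact hG W hcm hr0 hρ hT K hIQ hodd h3 hHe Dt hoptDt hc β ι d₁ hy M₀ hdiv hndiv
            (hQ4T hQ2 W hcm hT v h2v hNv hmv hpos K hIQ hodd h3 hHe hsq1 hsq2 hρ Dt β ι d₁ hy M₀ hdiv hndiv (hw Dt) Wd hWd hSel hTam
              n d hn hKoly hPn)
            Wd hWd hSel hBd
        · exact hOff W hcm hr0 hρ hT hopt (Or.inr (Or.inr ⟨hpos, h14⟩))
      · -- rev 54 (LINE 25 «s1_depth_zero»): additive-only at DEPTH ZERO — supply VERBATIM, K₁⁺, v-free `Ш(E/K)[2^∞] = 0`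
        by_cases h1 : Nat.card (W.selmerGroup 2) = 1
        · obtain ⟨K, _, _, hIQ, hodd, h3, hHe, hsq1, hsq2, Dt, β, ι, d₁, hoptDt, hc, hy, M₀, hdiv, hndiv,
            n, d, hn, hKoly, hPn, Wd, _, _, hWd, hcmd, hrd, hSel, hDEF⟩ := hP W hcm hr0 hρ hT hpos hopt (Or.inl h1)
          have hM0 : M₀ = 0 := by
            by_contra hne
            exact hK1P W hcm hr0 hρ hT hpos h1 K hIQ hodd h3 hHe hsq1 hsq2 Dt hoptDt hc β ι d₁ hy M₀ hdiv hndiv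
              (Nat.one_le_iff_ne_zero.mpr hne) Wd hWd hrd hSel hDEF
          subst hM0
          have hSha : Nat.card (AddCommGroup.primaryComponent (W.baseChange K).sha 2) = 2 ^ (2 * 0) := by
            rw [mul_zero, pow_zero]
            exact hSha1 W K hT hr0 h1 hIQ hodd hHe (by simpa using hρ 1 one_pos) Dt β ι d₁ hy 0 hndiv Wd hWd hSel
              (Or.inr ⟨hpos, hDEF⟩)
          have hBd : Literature.NumberTheory.EllipticCurves.BSDp Wd 2 := hcell0 hpos K Wd hWd hcmd hrd hSel hDEF
          exact hG W hcm hr0 hρ hT K hIQ hodd h3 hHe Dt hoptDt hc β ι d₁ hy 0 hdiv hndiv hSha Wd hWd hSel hBd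
        · exact hOff W hcm hr0 hρ hT hopt (Or.inl ⟨hmult, h1⟩)
  · exact hR W hcm hr hH

end Summit.BirchSwinnertonDyer.BirchSwinnertonDyer.Theorems.GenusExact.TwinSwap.Ledger.Line25

end
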